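import Literature.MathematicalPhysics.QuantumFieldTheory.BalabanImbrieJaffe1984to88.BIJ88GaussIntegration309Law

/-!
# `BalabanImbrieJaffe1984to88.BIJ88ChiFieldDeriv307` — T. Bałaban, J. Imbrie, A. Jaffe, *Effective action and cluster properties of
the abelian Higgs model*, Commun. Math. Phys. **114** (1988) 257–315 [BalabanImbrieJaffe1988]: p. 307 [PDF 51] (Sect. 5.13, the estimate
of `g₂(X_α)`), the located sentences *"Functional derivatives hitting χ-factors farther than ½r(e_k) from Λ₉^{(k)} produce factors
e^{−cp(e_k)²} after integrating with respect to A^{(k)″}, φ^{(k)″}. These derivatives are supported at |A^{(k)″}| ≥ cp(e_k) or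
|φ^{(k)″}| ≥ cp(e_k) (here we use the fact that the translation vanishes). … (Factorials can be produced when many functional
derivatives hit the same object, for example a characteristic function.)"*

statement-level skeleton of published theorems with citation tags; proofs where landed; nothing here is a claim about the Yang–Mills mass gap

WHAT THIS FILE ADDS.  The FIELD-derivative companion of this seat's p. 309 chain (`BIJ88ChiTDeriv309`, `BIJ88ChiTDerivN309`,
`BIJ88GaussIntegration309{,Phi,Product,Law}` treat the t-derivatives of the interpolated χ-factors).  Here the derivative is in the
field variable `x = A^{(k)″}(b)` of one χ-factor `χ(q, x) = χ(1, x/q)` ((5.2.4), `q = cp(e_k)`), all orders: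

* **§1 the profile off its shell** — `χ^{(n)}(1,y) = 0` for `|y| < 9/10`, `n ≥ 1` and for `|y| > 1`, all `n`
  (`iteratedDeriv_chi1_eq_zero_of_abs_lt`, `iteratedDeriv_chi1_eq_zero_of_one_lt`), hence a non-vanishing derivative of order `n ≥ 1`
  sits in the shell `9/10 ≤ |y| ≤ 1` (`abs_mem_shell_of_iteratedDeriv_chi1_ne_zero`).
* **§2 one χ-factor** — the scaling identity `∂ⁿ_x χ(q,x) = q^{−n} χ^{(n)}(1, x/q)` (`iteratedDeriv_cutoff`), the bound
  `|∂ⁿ_x χ(q,x)| ≤ cⁿn^{cn}|q|^{−n}` with the constant `c` of (5.2.3) (`abs_iteratedDeriv_cutoff_le` — the printed *"factorials … when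
  many functional derivatives hit the same … characteristic function"* are the `n^{cn}` of (5.2.3)), the printed support statement
  *"These derivatives are supported at |A^{(k)″}| ≥ cp(e_k)"* in the sharp form `(9/10)|q| ≤ |x| ≤ |q|` for `n ≥ 1`
  (`iteratedDeriv_cutoff_eq_zero_of_not_mem_shell`, `abs_iteratedDeriv_cutoff_le_indicator`).
* **§3 Gaussian integration** — *"produce factors e^{−cp(e_k)²} after integrating with respect to A^{(k)″}"*: for ANY finite measure
  `∫|∂ⁿ_x χ(q, X)|dμ ≤ cⁿn^{cn}|q|^{−n}·μ{(9/10)|q| ≤ |X|}` (`integral_abs_iteratedDeriv_cutoff_le_measureReal`), and for any real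
  observable `X` with CENTERED Gaussian law on any probability space (Mathlib `HasGaussianLaw`; the fluctuation field `A^{(k)″}` is
  centered Gaussian under the fluctuation measure — *"here we use the fact that the translation vanishes"*)
  `∫|∂ⁿ_x χ(q, X)|dP ≤ cⁿn^{cn}|q|^{−n}·2e^{−(81/200)q²/Var X}` (`integral_abs_iteratedDeriv_cutoff_le_of_hasGaussianLaw`) — with
  `q = cp(e_k)` the printed `e^{−cp(e_k)²}`.
* **§4 variance bound and the e_k-small regime** — with `Var X ≤ v` (degenerate `Var X = 0` included: the law is `δ₀` and the shell
  event is null) the factor is `2e^{−(81/200)q²/v}` (`real_abs_ge_le_of_variance_le`, `integral_abs_iteratedDeriv_cutoff_le_of_variance_le`),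
  and with the threshold `q = c₀·p(e_k)`, `p(·) = pLog p` of (2.33), in the regime `m + 1 ≤ (81c₀²/(200v))|log e_k⁻¹|^{2p−1}` it is
  `≤ 2e_k^{m+1}` (`integral_abs_iteratedDeriv_cutoff_pLog_le_pow`, via this seat's `BIJ88GaussFactor309.exp_pLog_sq_le_pow`) — several
  functional derivatives on several χ-factors multiply (`abs_prod_iteratedDeriv_cutoff_le`).

Scope: the complex field `φ^{(k)″}` enters the characteristic functions through `|φ|` ((5.2.2)); its functional derivatives are
two-dimensional and are not treated here (the tail `P{a ≤ |φ|}` for Gaussian `Re φ`, `Im φ` is `BIJ88GaussIntegration309Law.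
real_sqrt_sq_add_sq_ge_le_of_hasGaussianLaw`).  The clause *"farther than ½r(e_k) from Λ₉"* (where the translation vanishes, so the
field integrated is the centered fluctuation field) is modelled by the hypothesis `P[X] = 0`.

PDF held: `paper:balaban1988-cmp114-bij-abelian-higgs-effective-action` (journal page = PDF page + 256); p. 307 [PDF 51] re-read this
generation (`lit read … --pages 42-51`).

CITATION HEADER (lean-in-tree rule).  Part of the lit-balaban TYPED SKELETON (HOME `run/shared/lean/pub/lit-balaban/`), Phase 2,
seat p36 (gen 7, unit `lit-balaban-p36`); row **C2.Claim@307** of `HOME/lit-balaban-r16/ROWS-C2-part2.md` (owner r16; the typed leaves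
`BIJ88Sect5StatementsPart2.Ineq307`/`Ineq307unit` and p25's combinatorial core `BIJ88SmallPowerPerCube307` are NOT touched).  Theorems only;
no definitions, no `Prop` facts; axioms standard.
-/

namespace Literature.MathematicalPhysics.QuantumFieldTheory.BalabanImbrieJaffe1984to88.BIJ88ChiFieldDeriv307

open MeasureTheory ProbabilityTheory
open BIJ88Sect5Statements (CutoffProfile cutoff)
open BIJ88GaussIntegration309Law (real_abs_ge_le_of_hasGaussianLaw_centered)
open scoped Topology

/-! ## §1 The profile χ(1,·) off its shell: all derivatives vanish -/

section Profile

variable (χ : CutoffProfile)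

/-- Below the shell: for `|y| < 9/10` the profile is locally `1`, so `χ^{(n)}(1,y) = 0` for every `n ≥ 1`.
[cite: BalabanImbrieJaffe1988, (5.2.3) p.278] -/
theorem iteratedDeriv_chi1_eq_zero_of_abs_lt {n : ℕ} (hn : 1 ≤ n) {y : ℝ} (hy : |y| < 9 / 10) :
    iteratedDeriv n χ.χ₁ y = 0 := by
  have hev : χ.χ₁ =ᶠ[𝓝 y] fun _ => (1 : ℝ) := by
    filter_upwards [continuous_abs.continuousAt.eventually_lt_const hy] with z hz
    exact χ.eq_one z hz.le
  rw [hev.iteratedDeriv_eq, iteratedDeriv_const]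
  have : n ≠ 0 := by omega
  simp [this]

/-- Above the shell: for `|y| > 1` the profile is locally `0`, so `χ^{(n)}(1,y) = 0` for every `n`.
[cite: BalabanImbrieJaffe1988, (5.2.3) p.278] -/
theorem iteratedDeriv_chi1_eq_zero_of_one_lt (n : ℕ) {y : ℝ} (hy : 1 < |y|) :
    iteratedDeriv n χ.χ₁ y = 0 := by
  have hev : χ.χ₁ =ᶠ[𝓝 y] fun _ => (0 : ℝ) := by
    filter_upwards [continuous_abs.continuousAt.eventually_const_lt hy] with z hz
    exact χ.eq_zero z hz.le
  rw [hev.iteratedDeriv_eq, iteratedDeriv_const]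
  simp

/-- A non-vanishing derivative of order `n ≥ 1` of the profile sits in the shell `9/10 ≤ |y| ≤ 1`.
[cite: BalabanImbrieJaffe1988, (5.2.3) p.278] -/
theorem abs_mem_shell_of_iteratedDeriv_chi1_ne_zero {n : ℕ} (hn : 1 ≤ n) {y : ℝ} (h : iteratedDeriv n χ.χ₁ y ≠ 0) :
    9 / 10 ≤ |y| ∧ |y| ≤ 1 := by
  by_contra hc
  rcases not_and_or.mp hc with h1 | h1
  · exact h (iteratedDeriv_chi1_eq_zero_of_abs_lt χ hn (not_le.mp h1))
  · exact h (iteratedDeriv_chi1_eq_zero_of_one_lt χ n (not_le.mp h1))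

/-- The constant of (5.2.3) bounds nonnegative quantities: `0 ≤ cⁿ·n^{cn}` for the printed `c`.
[cite: BalabanImbrieJaffe1988, (5.2.3) p.278] -/
theorem deriv_bound_nonneg {c : ℝ} (hc : ∀ (n : ℕ) (x : ℝ), |iteratedDeriv n χ.χ₁ x| ≤ c ^ n * (n : ℝ) ^ (c * n)) (n : ℕ) :
    0 ≤ c ^ n * (n : ℝ) ^ (c * n) :=
  (abs_nonneg _).trans (hc n 0)

end Profile

/-! ## §2 One χ-factor: `∂ⁿ_x χ(q, x)` — scaling, the (5.2.3) bound ("factorials"), support in the shell -/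

section OneFactor

variable (χ : CutoffProfile)

/-- **Scaling** ((5.2.4) differentiated): `∂ⁿ_x χ(q,x) = q^{−n}·χ^{(n)}(1, x/q)`. [cite: BalabanImbrieJaffe1988, (5.2.4) p.278] -/
theorem iteratedDeriv_cutoff (q : ℝ) (n : ℕ) :
    iteratedDeriv n (cutoff χ q) = fun x => q⁻¹ ^ n * iteratedDeriv n χ.χ₁ (x / q) := by
  have hf : cutoff χ q = fun x => χ.χ₁ (q⁻¹ * x) := by
    funext x; simp only [cutoff, div_eq_mul_inv, mul_comm]
  have hχ : ContDiff ℝ n χ.χ₁ := χ.smooth.of_le (by exact_mod_cast le_top)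
  rw [hf, iteratedDeriv_comp_const_mul hχ]
  funext x
  rw [div_eq_mul_inv, mul_comm x]

/-- **The (5.2.3) bound for one χ-factor, all orders** — *"Factorials can be produced when many functional derivatives hit the same
object, for example a characteristic function"*: with the constant `c` of (5.2.3), for every threshold `q ≠ 0`, every order `n` and
every `x`, `|∂ⁿ_x χ(q,x)| ≤ cⁿ·n^{cn}·|q|^{−n}`. [cite: BalabanImbrieJaffe1988, p.307 (Sect. 5.13); (5.2.3)–(5.2.4) p.278] -/
theorem abs_iteratedDeriv_cutoff_le :
    ∃ c : ℝ, (∀ n : ℕ, 0 ≤ c ^ n * (n : ℝ) ^ (c * n)) ∧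
      ∀ (n : ℕ) (q x : ℝ), |iteratedDeriv n (cutoff χ q) x| ≤ c ^ n * (n : ℝ) ^ (c * n) * |q|⁻¹ ^ n := by
  obtain ⟨c, hc⟩ := χ.deriv_bound
  refine ⟨c, deriv_bound_nonneg χ hc, fun n q x => ?_⟩
  rw [iteratedDeriv_cutoff, abs_mul, abs_pow, abs_inv, mul_comm]
  exact mul_le_mul_of_nonneg_right (hc n (x / q)) (pow_nonneg (inv_nonneg.mpr (abs_nonneg q)) n)

/-- **Support** — *"These derivatives are supported at |A^{(k)″}| ≥ cp(e_k)"* (sharp form): for `n ≥ 1` and `q ≠ 0`,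
`∂ⁿ_x χ(q,x) = 0` unless `(9/10)|q| ≤ |x| ≤ |q|`. [cite: BalabanImbrieJaffe1988, p.307 (Sect. 5.13); (5.2.3)–(5.2.4) p.278] -/
theorem iteratedDeriv_cutoff_eq_zero_of_not_mem_shell {n : ℕ} (hn : 1 ≤ n) {q : ℝ} (hq : q ≠ 0) {x : ℝ}
    (hx : ¬ (9 / 10 * |q| ≤ |x| ∧ |x| ≤ |q|)) : iteratedDeriv n (cutoff χ q) x = 0 := by
  rw [iteratedDeriv_cutoff]
  beta_reduce
  have hq' : 0 < |q| := abs_pos.mpr hq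
  by_contra hne
  have hne' : iteratedDeriv n χ.χ₁ (x / q) ≠ 0 := fun h0 => hne (by rw [h0, mul_zero])
  have hsh := abs_mem_shell_of_iteratedDeriv_chi1_ne_zero χ hn hne'
  rw [abs_div, le_div_iff₀ hq', div_le_iff₀ hq', one_mul] at hsh
  exact hx hsh

/-- Contrapositive: a non-vanishing `∂ⁿ_x χ(q,x)` (`n ≥ 1`, `q ≠ 0`) forces `(9/10)|q| ≤ |x| ≤ |q|`.
[cite: BalabanImbrieJaffe1988, p.307 (Sect. 5.13)] -/
theorem mem_shell_of_iteratedDeriv_cutoff_ne_zero {n : ℕ} (hn : 1 ≤ n) {q : ℝ} (hq : q ≠ 0) {x : ℝ}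
    (h : iteratedDeriv n (cutoff χ q) x ≠ 0) : 9 / 10 * |q| ≤ |x| ∧ |x| ≤ |q| := by
  by_contra hx
  exact h (iteratedDeriv_cutoff_eq_zero_of_not_mem_shell χ hn hq hx)

/-- **Bound × support in one line**: for `n ≥ 1`, `q ≠ 0`:
`|∂ⁿ_x χ(q,x)| ≤ cⁿn^{cn}|q|^{−n} · 𝟙{(9/10)|q| ≤ |x| ≤ |q|}`. [cite: BalabanImbrieJaffe1988, p.307 (Sect. 5.13)] -/
theorem abs_iteratedDeriv_cutoff_le_indicator :
    ∃ c : ℝ, (∀ n : ℕ, 0 ≤ c ^ n * (n : ℝ) ^ (c * n)) ∧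
      ∀ (n : ℕ), 1 ≤ n → ∀ (q : ℝ), q ≠ 0 → ∀ x : ℝ,
        |iteratedDeriv n (cutoff χ q) x| ≤
          c ^ n * (n : ℝ) ^ (c * n) * |q|⁻¹ ^ n * Set.indicator {y : ℝ | 9 / 10 * |q| ≤ |y| ∧ |y| ≤ |q|} (fun _ => (1 : ℝ)) x := by
  obtain ⟨c, hc0, hc⟩ := abs_iteratedDeriv_cutoff_le χ
  refine ⟨c, hc0, fun n hn q hq x => ?_⟩
  by_cases hx : x ∈ {y : ℝ | 9 / 10 * |q| ≤ |y| ∧ |y| ≤ |q|}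
  · rw [Set.indicator_of_mem hx, mul_one]
    exact hc n q x
  · rw [Set.indicator_of_notMem hx, mul_zero, iteratedDeriv_cutoff_eq_zero_of_not_mem_shell χ hn hq hx, abs_zero]

/-- The complementary large-field function `χ^c = 1 − χ` has the same derivatives up to sign for `n ≥ 1`:
`∂ⁿ_x χ^c(q,x) = −∂ⁿ_x χ(q,x)`. [cite: BalabanImbrieJaffe1988, (5.2.2) p.278] -/
theorem iteratedDeriv_cutoffC {n : ℕ} (hn : 1 ≤ n) (q x : ℝ) :
    iteratedDeriv n (BIJ88Sect5Statements.cutoffC χ q) x = -iteratedDeriv n (cutoff χ q) x := by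
  have h : BIJ88Sect5Statements.cutoffC χ q = fun y => (1 : ℝ) - cutoff χ q y := by
    funext y; rfl
  rw [h, iteratedDeriv_const_sub (by omega) (1 : ℝ), iteratedDeriv_neg]

end OneFactor

/-! ## §3 *"produce factors e^{−cp(e_k)²} after integrating with respect to A^{(k)″}"* -/

section Integration

variable (χ : CutoffProfile) {Ω : Type*} [MeasurableSpace Ω]

/-- `x ↦ ∂ⁿ_x χ(q,x)` is continuous (χ is `C^∞`). [cite: BalabanImbrieJaffe1988, (5.2.3) p.278] -/
theorem continuous_iteratedDeriv_cutoff (q : ℝ) (n : ℕ) : Continuous (iteratedDeriv n (cutoff χ q)) := by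
  rw [iteratedDeriv_cutoff]
  have hχ : Continuous (iteratedDeriv n χ.χ₁) := χ.smooth.continuous_iteratedDeriv n (by exact_mod_cast le_top)
  exact continuous_const.mul (hχ.comp (continuous_id.div_const q))

/-- **Integration against ANY finite measure**: for measurable `X`, `n ≥ 1`, `q ≠ 0`,
`∫ |∂ⁿ_x χ(q, X(ω))| dμ ≤ cⁿn^{cn}|q|^{−n} · μ{(9/10)|q| ≤ |X|}` — only the single-field tail is needed.
[cite: BalabanImbrieJaffe1988, p.307 (Sect. 5.13)] -/
theorem integral_abs_iteratedDeriv_cutoff_le_measureReal :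
    ∃ c : ℝ, (∀ n : ℕ, 0 ≤ c ^ n * (n : ℝ) ^ (c * n)) ∧
      ∀ (μ : Measure Ω) [IsFiniteMeasure μ] (X : Ω → ℝ), Measurable X → ∀ (n : ℕ), 1 ≤ n → ∀ (q : ℝ), q ≠ 0 →
        ∫ ω, |iteratedDeriv n (cutoff χ q) (X ω)| ∂μ ≤
          c ^ n * (n : ℝ) ^ (c * n) * |q|⁻¹ ^ n * μ.real {ω | 9 / 10 * |q| ≤ |X ω|} := by
  obtain ⟨c, hc0, hc⟩ := abs_iteratedDeriv_cutoff_le_indicator χ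
  refine ⟨c, hc0, ?_⟩
  intro μ _ X hXm n hn q hq
  set S : Set Ω := {ω | 9 / 10 * |q| ≤ |X ω|} with hS
  have hSm : MeasurableSet S := measurableSet_le measurable_const hXm.abs
  set K : ℝ := c ^ n * (n : ℝ) ^ (c * n) * |q|⁻¹ ^ n with hK
  have hK0 : 0 ≤ K := mul_nonneg (hc0 n) (pow_nonneg (inv_nonneg.mpr (abs_nonneg q)) n)
  have hpt : ∀ ω, |iteratedDeriv n (cutoff χ q) (X ω)| ≤ S.indicator (fun _ => K) ω := by
    intro ω
    refine (hc n hn q hq (X ω)).trans ?_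
    by_cases hω : ω ∈ S
    · rw [Set.indicator_of_mem hω]
      exact mul_le_of_le_one_right hK0 (Set.indicator_apply_le' (fun _ => le_rfl) (fun _ => zero_le_one))
    · have hω' : X ω ∉ {y : ℝ | 9 / 10 * |q| ≤ |y| ∧ |y| ≤ |q|} := fun h => hω h.1
      rw [Set.indicator_of_notMem hω, Set.indicator_of_notMem hω', mul_zero]
  have hint : Integrable (S.indicator fun _ => K) μ := (integrable_const K).indicator hSm
  calc ∫ ω, |iteratedDeriv n (cutoff χ q) (X ω)| ∂μ
      ≤ ∫ ω, S.indicator (fun _ => K) ω ∂μ :=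
        integral_mono_of_nonneg (Filter.Eventually.of_forall fun ω => abs_nonneg _) hint (Filter.Eventually.of_forall hpt)
    _ = μ.real S * K := by rw [integral_indicator_const K hSm, smul_eq_mul]
    _ = K * μ.real {ω | 9 / 10 * |q| ≤ |X ω|} := by rw [mul_comm]

/-- **p. 307, the Gaussian factor** — *"Functional derivatives hitting χ-factors … produce factors e^{−cp(e_k)²} after integrating with
respect to A^{(k)″}"*: on ANY probability space, for ANY real observable `X` with CENTERED Gaussian law (*"the translation vanishes"*),
`n ≥ 1`, `q ≠ 0`:  `∫ |∂ⁿ_x χ(q, X)| dP ≤ cⁿn^{cn}|q|^{−n} · 2e^{−(81/200)q²/Var X}` — with `q = cp(e_k)` the printed `e^{−cp(e_k)²}`,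
times the (5.2.3) "factorials". [cite: BalabanImbrieJaffe1988, p.307 (Sect. 5.13)] -/
theorem integral_abs_iteratedDeriv_cutoff_le_of_hasGaussianLaw :
    ∃ c : ℝ, (∀ n : ℕ, 0 ≤ c ^ n * (n : ℝ) ^ (c * n)) ∧
      ∀ (P : Measure Ω) (X : Ω → ℝ), HasGaussianLaw X P → Measurable X → P[X] = 0 → ∀ (n : ℕ), 1 ≤ n → ∀ (q : ℝ), q ≠ 0 →
        ∫ ω, |iteratedDeriv n (cutoff χ q) (X ω)| ∂P ≤
          c ^ n * (n : ℝ) ^ (c * n) * |q|⁻¹ ^ n * (2 * Real.exp (-(81 / 200 * q ^ 2 / Var[X; P]))) := by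
  obtain ⟨c, hc0, hc⟩ := integral_abs_iteratedDeriv_cutoff_le_measureReal (Ω := Ω) χ
  refine ⟨c, hc0, ?_⟩
  intro P X hX hXm h0 n hn q hq
  haveI := hX.isProbabilityMeasure
  have hK0 : 0 ≤ c ^ n * (n : ℝ) ^ (c * n) * |q|⁻¹ ^ n := mul_nonneg (hc0 n) (pow_nonneg (inv_nonneg.mpr (abs_nonneg q)) n)
  have htail := real_abs_ge_le_of_hasGaussianLaw_centered hX hXm h0 (a := 9 / 10 * |q|) (by positivity)
  have hexp : 2 * Real.exp (-((9 / 10 * |q|) ^ 2 / (2 * Var[X; P]))) = 2 * Real.exp (-(81 / 200 * q ^ 2 / Var[X; P])) := by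
    congr 2
    rw [mul_pow, sq_abs]
    ring
  refine (hc P X hXm n hn q hq).trans ?_
  rw [← hexp]
  exact mul_le_mul_of_nonneg_left htail hK0

/-- **Several functional derivatives on several χ-factors.**  When `m_b ≥ 1` derivatives hit the factor `χ(q_b, x_b)` for each `b` in a
finite family `B`, the product obeys `Π_b |∂^{m_b} χ(q_b, x_b)| ≤ Π_b (c^{m_b} m_b^{c m_b} |q_b|^{−m_b})`, and it vanishes unless EVERY hit
field is in its shell. [cite: BalabanImbrieJaffe1988, p.307 (Sect. 5.13)] -/
theorem abs_prod_iteratedDeriv_cutoff_le {ι : Type*} :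
    ∃ c : ℝ, (∀ n : ℕ, 0 ≤ c ^ n * (n : ℝ) ^ (c * n)) ∧
      ∀ (B : Finset ι) (m : ι → ℕ) (q x : ι → ℝ), (∀ b ∈ B, 1 ≤ m b) → (∀ b ∈ B, q b ≠ 0) →
        |∏ b ∈ B, iteratedDeriv (m b) (cutoff χ (q b)) (x b)| ≤
            ∏ b ∈ B, c ^ (m b) * (m b : ℝ) ^ (c * m b) * |q b|⁻¹ ^ (m b) ∧
          ((∃ b ∈ B, ¬ (9 / 10 * |q b| ≤ |x b| ∧ |x b| ≤ |q b|)) →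
            ∏ b ∈ B, iteratedDeriv (m b) (cutoff χ (q b)) (x b) = 0) := by
  obtain ⟨c, hc0, hc⟩ := abs_iteratedDeriv_cutoff_le χ
  refine ⟨c, hc0, fun B m q x hm hq => ⟨?_, ?_⟩⟩
  · rw [Finset.abs_prod]
    exact Finset.prod_le_prod (fun b _ => abs_nonneg _) fun b _ => hc (m b) (q b) (x b)
  · rintro ⟨b, hb, hxb⟩
    exact Finset.prod_eq_zero hb (iteratedDeriv_cutoff_eq_zero_of_not_mem_shell χ (hm b hb) (hq b hb) hxb)

end Integration

/-! ## §4 With a variance bound `Var X ≤ v` and the threshold `q = c₀·p(e_k)`: the factor `e^{−cp(e_k)²}` as a power of `e_k` -/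

section Regime

variable (χ : CutoffProfile) {Ω : Type*} [MeasurableSpace Ω]

open BIJ88Sect2Statements (pLog)

/-- The shell tail under a variance bound: for a real observable `X` with CENTERED Gaussian law, `Var X ≤ v` (the degenerate
case `Var X = 0` included — the law is then `δ₀` and the shell event is null) and `q ≠ 0`:
`P{(9/10)|q| ≤ |X|} ≤ 2e^{−(81/200)q²/v}`. [cite: BalabanImbrieJaffe1988, p.307 (Sect. 5.13)] -/
theorem real_abs_ge_le_of_variance_le {P : Measure Ω} {X : Ω → ℝ} (hX : HasGaussianLaw X P) (hXm : Measurable X)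
    (h0 : P[X] = 0) {v : ℝ} (hvar : Var[X; P] ≤ v) {q : ℝ} (hq : q ≠ 0) :
    P.real {ω | 9 / 10 * |q| ≤ |X ω|} ≤ 2 * Real.exp (-(81 / 200 * q ^ 2 / v)) := by
  have hapos : 0 < 9 / 10 * |q| := by have := abs_pos.mpr hq; positivity
  by_cases hV : Var[X; P] = 0
  · -- degenerate law δ₀: the event is null
    have hT : MeasurableSet {x : ℝ | 9 / 10 * |q| ≤ |x|} := measurableSet_le measurable_const continuous_abs.measurable
    have hmap : P.map X = Measure.dirac 0 := by
      rw [hX.map_eq_gaussianReal, h0, hV, Real.toNNReal_zero, gaussianReal_zero_var]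
    have hzero : P.real {ω | 9 / 10 * |q| ≤ |X ω|} = 0 := by
      rw [measureReal_def, show {ω | 9 / 10 * |q| ≤ |X ω|} = X ⁻¹' {x : ℝ | 9 / 10 * |q| ≤ |x|} from rfl,
        ← Measure.map_apply hXm hT, hmap, Measure.dirac_apply' _ hT, Set.indicator_of_notMem]
      · simp
      · simp only [Set.mem_setOf_eq, abs_zero, not_le]; exact hapos
    rw [hzero]
    positivity
  · refine (real_abs_ge_le_of_hasGaussianLaw_centered hX hXm h0 hapos.le).trans ?_
    refine mul_le_mul_of_nonneg_left ?_ (by norm_num)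
    have hVpos : 0 < Var[X; P] := lt_of_le_of_ne (variance_nonneg _ _) (Ne.symm hV)
    have hx : 0 ≤ (9 / 10 * |q|) ^ 2 / 2 := by positivity
    have e1 : (9 / 10 * |q|) ^ 2 / (2 * Var[X; P]) = ((9 / 10 * |q|) ^ 2 / 2) / Var[X; P] := by rw [div_div]
    have e2 : 81 / 200 * q ^ 2 / v = ((9 / 10 * |q|) ^ 2 / 2) / v := by
      rw [mul_pow, sq_abs]; ring
    rw [e1, e2]
    exact BIJ88GaussIntegration309Law.exp_neg_div_mono hx hVpos hvar

/-- **p. 307 with a variance bound**: `∫ |∂ⁿ_x χ(q, X)| dP ≤ cⁿn^{cn}|q|^{−n} · 2e^{−(81/200)q²/v}` for every real observable `X` with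
centered Gaussian law and `Var X ≤ v`, `n ≥ 1`, `q ≠ 0`. [cite: BalabanImbrieJaffe1988, p.307 (Sect. 5.13)] -/
theorem integral_abs_iteratedDeriv_cutoff_le_of_variance_le :
    ∃ c : ℝ, (∀ n : ℕ, 0 ≤ c ^ n * (n : ℝ) ^ (c * n)) ∧
      ∀ (P : Measure Ω) (X : Ω → ℝ), HasGaussianLaw X P → Measurable X → P[X] = 0 → ∀ (v : ℝ), Var[X; P] ≤ v →
        ∀ (n : ℕ), 1 ≤ n → ∀ (q : ℝ), q ≠ 0 →
          ∫ ω, |iteratedDeriv n (cutoff χ q) (X ω)| ∂P ≤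
            c ^ n * (n : ℝ) ^ (c * n) * |q|⁻¹ ^ n * (2 * Real.exp (-(81 / 200 * q ^ 2 / v))) := by
  obtain ⟨c, hc0, hc⟩ := integral_abs_iteratedDeriv_cutoff_le_measureReal (Ω := Ω) χ
  refine ⟨c, hc0, ?_⟩
  intro P X hX hXm h0 v hvar n hn q hq
  haveI := hX.isProbabilityMeasure
  have hK0 : 0 ≤ c ^ n * (n : ℝ) ^ (c * n) * |q|⁻¹ ^ n := mul_nonneg (hc0 n) (pow_nonneg (inv_nonneg.mpr (abs_nonneg q)) n)
  exact (hc P X hXm n hn q hq).trans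
    (mul_le_mul_of_nonneg_left (real_abs_ge_le_of_variance_le hX hXm h0 hvar hq) hK0)

/-- **The printed factor `e^{−cp(e_k)²}` is a high power of `e_k`** (the paper's standing small-coupling bookkeeping, as in this seat's
`BIJ88GaussFactor309.exp_pLog_sq_le_pow`): with the threshold `q = c₀·p(e_k)` of (5.2.2) (`p(·) = pLog p` of (2.33), `1/2 < p`,
`0 < e_k ≤ 1`, `c₀ ≠ 0`), centered Gaussian `X` with `Var X ≤ v`, and the regime `m + 1 ≤ (81c₀²/(200v))|log e_k⁻¹|^{2p−1}`:
`∫ |∂ⁿ_x χ(c₀p(e_k), X)| dP ≤ cⁿn^{cn}|c₀p(e_k)|^{−n} · 2e_k^{m+1}`. [cite: BalabanImbrieJaffe1988, p.307 (Sect. 5.13); (2.33) p.263] -/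
theorem integral_abs_iteratedDeriv_cutoff_pLog_le_pow :
    ∃ c : ℝ, (∀ n : ℕ, 0 ≤ c ^ n * (n : ℝ) ^ (c * n)) ∧
      ∀ (P : Measure Ω) (X : Ω → ℝ), HasGaussianLaw X P → Measurable X → P[X] = 0 → ∀ (v : ℝ), 0 < v → Var[X; P] ≤ v →
        ∀ ⦃c₀ ek p : ℝ⦄ (m : ℕ), c₀ ≠ 0 → 0 < ek → ek ≤ 1 → 1 / 2 < p →
          (m : ℝ) + 1 ≤ 81 / 200 * (c₀ ^ 2 / v) * Real.log ek⁻¹ ^ (2 * p - 1) → ∀ (n : ℕ), 1 ≤ n →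
            ∫ ω, |iteratedDeriv n (cutoff χ (c₀ * pLog p ek)) (X ω)| ∂P ≤
              c ^ n * (n : ℝ) ^ (c * n) * |c₀ * pLog p ek|⁻¹ ^ n * (2 * ek ^ (m + 1)) := by
  obtain ⟨c, hc0, hc⟩ := integral_abs_iteratedDeriv_cutoff_le_of_variance_le (Ω := Ω) χ
  refine ⟨c, hc0, ?_⟩
  intro P X hX hXm h0 v hv hvar c₀ ek p m hc₀ hek hek1 hp hreg n hn
  have hpl : 0 < pLog p ek := by
    rcases lt_or_eq_of_le hek1 with h1 | h1
    · have hL : 0 < -Real.log ek := by have := Real.log_neg hek h1; linarith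
      rw [BIJ88ChiTDeriv309.pLog_eq_rpow_neg_log p hek h1]; exact Real.rpow_pos_of_pos hL p
    · -- at e_k = 1 the regime forces m + 1 ≤ 0, impossible; but pLog p 1 = |log 1|^p = 0^p: exclude via hreg
      exfalso
      have hp' : 2 * p - 1 ≠ 0 := by linarith
      rw [h1, inv_one, Real.log_one, Real.zero_rpow hp', mul_zero] at hreg
      have : (0 : ℝ) ≤ m := Nat.cast_nonneg m
      linarith
  have hq : c₀ * pLog p ek ≠ 0 := mul_ne_zero hc₀ hpl.ne'
  refine (hc P X hX hXm h0 v hvar n hn (c₀ * pLog p ek) hq).trans ?_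
  have hK0 : 0 ≤ c ^ n * (n : ℝ) ^ (c * n) * |c₀ * pLog p ek|⁻¹ ^ n :=
    mul_nonneg (hc0 n) (pow_nonneg (inv_nonneg.mpr (abs_nonneg _)) n)
  refine mul_le_mul_of_nonneg_left (mul_le_mul_of_nonneg_left ?_ (by norm_num)) hK0
  have hgf := BIJ88GaussFactor309.exp_pLog_sq_le_pow (x := ek) (ek := ek) (c := 81 / 200 * (c₀ ^ 2 / v)) (p := p) (n := m)
    hek le_rfl hek1 hp (by positivity) hreg
  have e : 81 / 200 * (c₀ * pLog p ek) ^ 2 / v = 81 / 200 * (c₀ ^ 2 / v) * pLog p ek ^ 2 := by ring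
  rw [e]
  exact hgf

end Regime

end Literature.MathematicalPhysics.QuantumFieldTheory.BalabanImbrieJaffe1984to88.BIJ88ChiFieldDeriv307
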